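import Summits.CriticalPhenomena.PercolationContinuityZ3.Theorems.PercNearOneGluingNoHeavyLowerTailE3GroupSepLeFive

/-!
# Crux `PercNearOneGluing.AdditiveGluing` (stmt-CriticalPhenomena-4576): the two COV-Π rows `T2_Q`, `T3_Q` that close
# Kozma–Nitzan's Conjecture 1 for `|A| = 3` hold on every weighted graph on five vertices — kernel-checked, and in fact
# three-copy FIBREWISE (Richards-comb) positive on `K₅`

Support file (lead-of-record `prim-png-lead-4576` gen 10; `--supports stmt-CriticalPhenomena-4576`; COMPUTATIONAL: two `checkC`
evaluations by `native_decide`, plus the finite cover of the distinct tuples of `Fin 5` reused from `…E3GroupSepLeFive`).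

Context.  The surplus-transfer inequality `(S5)₂`, hence `GEN(3)`, `AG-loc(3)`, `AdditiveGluing` for three relays and
Kozma–Nitzan's Conjecture 1 for `|A| = 3`, follow in the tree from ONE conditional covariance transfer (hp-4's `…SurplusTransferPair`:
`surplusTransfer_pair_of_plusTransfer`, `kn_conj1_three_of_plusTransfer`; lead gen 8 `…GammaTransfer`).  For the indicator functional
`F = 1{b′ ∈ ·}` that Conjecture 1 needs, the transfer is the pair of five-terminal CUBIC inequalities (terminals `o, a₁, a₂, a₃, b′`;
`Q = {a₁ ↮ a₂}`, `D = {a₃ ↮ a₁} ∩ {a₃ ↮ a₂}`; all probabilities under `μ = prodBernoulli w`)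

  `T2_Q`:  `μ(D∩Q)·[μ(Q)μ(b′↔a₂, o↔a₂, Q) − μ(b′↔a₂, Q)μ(o↔a₂, Q)] ≥ μ(D∩Q∩{o↔a₃})·[μ(Q)μ(b′↔a₂, a₃↔a₂, Q) − μ(b′↔a₂, Q)μ(a₃↔a₂, Q)]`
  `T3_Q`:  `μ(D∩Q∩{o↔a₃})·[μ(Q)μ(b′↔a₁, a₃↔a₂, Q) − μ(b′↔a₁, Q)μ(a₃↔a₂, Q)] ≥ μ(D∩Q)·[μ(Q)μ(b′↔a₁, o↔a₂, Q) − μ(b′↔a₁, Q)μ(o↔a₂, Q)]`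

(= COV-Π `ν(D)·Cov_ν(h, 1{o∈C_{a₂}}) ≥ ν(o↔a₃, D)·Cov_ν(h, 1{a₃∈C_{a₂}})`, `ν = μ(·|Q)`, at `h = 1{b′∈C_{a₂}}` resp. `h = −1{b′∈C_{a₁}}`;
census-clean on 11.0 M placements n ≤ 9, ttrl gen/S5.md).  Both are OPEN for general graphs.

**Theorems `t2Q_five`, `t3Q_five`.**  For every `w : Sym2 (Fin 5) → [0,1]` and every pairwise distinct `(o, a₁, a₂, a₃, b′)` in `Fin 5`
both rows hold (stated as `0 ≤ cval w (t2Terms t)` / `(t3Terms t)`, `cval` = the signed sum of triple products of `connEvent`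
probabilities of `…E3GroupSepCertCheck`; `t2Q_five_explicit` spells `T2_Q` out as an inequality between products of
`prodBernoulli w`-probabilities of intersections of `openConn` events).  Proof: the generic three-copy checker `checkC` passes at the
standard tuple (`native_decide`) — i.e. ALL `4^10` tensor-Bernstein fibre sums of each cubic are nonnegative integers on `K₅`, the
signature of a copy-SWITCHING proof (as for the covariance transfer (T), `…CovTransferCertLeFive`, and the E3GRP rows) — and the other
distinct tuples follow by transport along vertex relabellings (`cover_distinct` of `…E3GroupSepLeFive`).  Fibre positivity was found
first with an independent exact polynomial computation (lead memo LeadMath-g10, lab-g10/fibre.py: 882 432 / 862 560 nonzero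
tensor-Bernstein coefficients, all ≥ 0; also for `h = 1{o∈·}`, `1{b′,o∈·}`, `1{b′∈· ∨ a₃∈·}`, `1{b′∈· ∨ o∈·}`).
[cite: KozmaNitzan2024, Conj. 1 (p. 3)] [cite: VandenbergHaggstromKahn2005, Thm. 1.5 (p. 7)]
-/

namespace Summit.CriticalPhenomena.PercolationContinuityZ3.Theorems.CovPiComb

open Finset MeasureTheory OneCutCert CovTransferCert E3GroupSepCert
open scoped BigOperators
open Literature.Probability.Percolation Literature.Probability.LatticeModels

variable {n : ℕ}

/-! ## The two rows as signed cubic term lists (terminal order `o, a₁, a₂, a₃, b′`) -/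

/-- `Q = {a₁ ↮ a₂}`. [this work] -/
def pQ (t : Tup n) : CRel n → Bool := fun r => !(r t.2.1 t.2.2.1)
/-- `D ∩ Q = {a₃ ↮ a₁} ∩ {a₃ ↮ a₂} ∩ {a₁ ↮ a₂}`. [this work] -/
def pDQ (t : Tup n) : CRel n → Bool := fun r => !(r t.2.2.2.1 t.2.1) && !(r t.2.2.2.1 t.2.2.1) && !(r t.2.1 t.2.2.1)
/-- `D ∩ Q ∩ {o ↔ a₃}`. [this work] -/
def pDOQ (t : Tup n) : CRel n → Bool := fun r => pDQ t r && r t.1 t.2.2.2.1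
/-- `{x ↔ a₂} ∩ Q` for a terminal `x`. [this work] -/
def pIn (t : Tup n) (x : Fin n) : CRel n → Bool := fun r => r x t.2.2.1 && pQ t r
/-- `{x ↔ a₂} ∩ {y ↔ a₂} ∩ Q`. [this work] -/
def pIn2 (t : Tup n) (x y : Fin n) : CRel n → Bool := fun r => r x t.2.2.1 && r y t.2.2.1 && pQ t r
/-- `{b′ ↔ a₁} ∩ Q` (the target in the AVOIDED relay's cluster). [this work] -/
def pInA (t : Tup n) : CRel n → Bool := fun r => r t.2.2.2.2 t.2.1 && pQ t r
/-- `{b′ ↔ a₁} ∩ {y ↔ a₂} ∩ Q`. [this work] -/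
def pInA2 (t : Tup n) (y : Fin n) : CRel n → Bool := fun r => r t.2.2.2.2 t.2.1 && r y t.2.2.1 && pQ t r

/-- The four cubic terms of `T2_Q` (left minus right). [this work] -/
def t2Terms (t : Tup n) : List (CTerm n) :=
  [((1 : ℤ), pDQ t, pQ t, pIn2 t t.2.2.2.2 t.1), (-1, pDQ t, pIn t t.2.2.2.2, pIn t t.1),
   (-1, pDOQ t, pQ t, pIn2 t t.2.2.2.2 t.2.2.2.1), (1, pDOQ t, pIn t t.2.2.2.2, pIn t t.2.2.2.1)]

/-- The four cubic terms of `T3_Q` (left minus right). [this work] -/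
def t3Terms (t : Tup n) : List (CTerm n) :=
  [((-1 : ℤ), pDQ t, pQ t, pInA2 t t.1), (1, pDQ t, pInA t, pIn t t.1),
   (1, pDOQ t, pQ t, pInA2 t t.2.2.2.1), (-1, pDOQ t, pInA t, pIn t t.2.2.2.1)]

/-! ## Transport along vertex relabellings -/

/-- Probabilities of connectivity events under relabelled weights. [this work] -/
theorem pr_relabelW (σ : Fin n ≃ Fin n) (w : Sym2 (Fin n) → unitInterval) (P : CRel n → Bool) :
    pr (relabelW σ w) P = pr w (relP σ.symm P) := by
  unfold pr
  rw [← prodBernoulli_real_preimage_relabel (sym2Equiv σ) w (relabelW σ w) (relabelW_apply σ w), preimage_relabel_connEvent]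

/-- `cval` under relabelled weights: relabel the predicates. [this work] -/
theorem cval_relabelW (σ : Fin n ≃ Fin n) (w : Sym2 (Fin n) → unitInterval) (ts : List (CTerm n)) :
    cval (relabelW σ w) ts = cval w (ts.map fun t => (t.1, relP σ.symm t.2.1, relP σ.symm t.2.2.1, relP σ.symm t.2.2.2)) := by
  unfold cval
  rw [List.map_map]
  congr 1
  apply List.map_congr_left
  intro t _
  simp [pr_relabelW]

/-- The `T2_Q` terms under relabelling. [this work] -/
theorem t2Terms_relP (τ : Fin n ≃ Fin n) (t : Tup n) :
    ((t2Terms t).map fun u => (u.1, relP τ u.2.1, relP τ u.2.2.1, relP τ u.2.2.2)) = t2Terms (tmap τ t) := by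
  obtain ⟨o, a₁, a₂, a₃, b⟩ := t
  rfl

/-- The `T3_Q` terms under relabelling. [this work] -/
theorem t3Terms_relP (τ : Fin n ≃ Fin n) (t : Tup n) :
    ((t3Terms t).map fun u => (u.1, relP τ u.2.1, relP τ u.2.2.1, relP τ u.2.2.2)) = t3Terms (tmap τ t) := by
  obtain ⟨o, a₁, a₂, a₃, b⟩ := t
  rfl

/-- `T2_Q` at all weights for a tuple gives it at all weights for every relabelled tuple. [this work] -/
theorem t2Holds_forall_relabel (σ : Fin n ≃ Fin n) {t : Tup n} (h : ∀ w : Sym2 (Fin n) → unitInterval, 0 ≤ cval w (t2Terms t))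
    (w : Sym2 (Fin n) → unitInterval) : 0 ≤ cval w (t2Terms (tmap σ t)) := by
  have hw : relabelW σ (fun e => w (sym2Equiv σ e)) = w := by
    funext e; unfold relabelW; simp only [Equiv.apply_symm_apply]
  have hr := t2Terms_relP σ.symm (tmap σ t)
  rw [tmap_symm_tmap] at hr
  rw [← hw, cval_relabelW, hr]
  exact h _

/-- `T3_Q` at all weights for a tuple gives it at all weights for every relabelled tuple. [this work] -/
theorem t3Holds_forall_relabel (σ : Fin n ≃ Fin n) {t : Tup n} (h : ∀ w : Sym2 (Fin n) → unitInterval, 0 ≤ cval w (t3Terms t))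
    (w : Sym2 (Fin n) → unitInterval) : 0 ≤ cval w (t3Terms (tmap σ t)) := by
  have hw : relabelW σ (fun e => w (sym2Equiv σ e)) = w := by
    funext e; unfold relabelW; simp only [Equiv.apply_symm_apply]
  have hr := t3Terms_relP σ.symm (tmap σ t)
  rw [tmap_symm_tmap] at hr
  rw [← hw, cval_relabelW, hr]
  exact h _

/-! ## The evaluations at the standard tuple (three-copy fibre positivity on `K₅`) -/

/-- `T2_Q` passes the three-copy check at the standard tuple of `K₅` (base `2^34`): all `4^10` fibre sums are `≥ 0`. [this work] -/
theorem check_t2 : checkC 5 34 (t2Terms t₀) = true := by native_decide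

/-- `T3_Q` passes the three-copy check at the standard tuple of `K₅` (base `2^34`): all `4^10` fibre sums are `≥ 0`. [this work] -/
theorem check_t3 : checkC 5 34 (t3Terms t₀) = true := by native_decide

/-- `T2_Q` at the standard tuple for all weights. [this work] -/
theorem t2Holds_t₀ (w : Sym2 (Fin 5) → unitInterval) : 0 ≤ cval w (t2Terms t₀) := checkC_sound 34 _ check_t2 w

/-- `T3_Q` at the standard tuple for all weights. [this work] -/
theorem t3Holds_t₀ (w : Sym2 (Fin 5) → unitInterval) : 0 ≤ cval w (t3Terms t₀) := checkC_sound 34 _ check_t3 w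

/-! ## The theorems -/

/-- **`T2_Q` on every weighted graph on five vertices**: for every `w : Sym2 (Fin 5) → [0,1]` and every pairwise distinct
`(o, a₁, a₂, a₃, b′)`, `0 ≤ cval w (t2Terms (o,a₁,a₂,a₃,b′))`, i.e.
`μ(DQ)μ(Q)μ(b′a₂, oa₂, Q) + μ(DQ, oa₃)μ(b′a₂,Q)μ(a₃a₂,Q) ≥ μ(DQ)μ(b′a₂,Q)μ(oa₂,Q) + μ(DQ,oa₃)μ(Q)μ(b′a₂, a₃a₂, Q)`.
Kernel-checked three-copy certificate + relabelling. [this work] -/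
theorem t2Q_five (w : Sym2 (Fin 5) → unitInterval) (o a₁ a₂ a₃ b : Fin 5) (h01 : o ≠ a₁) (h02 : o ≠ a₂) (h03 : o ≠ a₃)
    (h04 : o ≠ b) (h12 : a₁ ≠ a₂) (h13 : a₁ ≠ a₃) (h14 : a₁ ≠ b) (h23 : a₂ ≠ a₃) (h24 : a₂ ≠ b) (h34 : a₃ ≠ b) :
    0 ≤ cval w (t2Terms ((o, a₁, a₂, a₃, b) : Tup 5)) := by
  obtain ⟨σ, hσ⟩ := cover_distinct _ (mem_distinctTuples h01 h02 h03 h04 h12 h13 h14 h23 h24 h34)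
  rw [← hσ]
  exact t2Holds_forall_relabel σ t2Holds_t₀ w

/-- **`T3_Q` on every weighted graph on five vertices**: for every `w : Sym2 (Fin 5) → [0,1]` and every pairwise distinct
`(o, a₁, a₂, a₃, b′)`, `0 ≤ cval w (t3Terms (o,a₁,a₂,a₃,b′))`. Kernel-checked three-copy certificate + relabelling. [this work] -/
theorem t3Q_five (w : Sym2 (Fin 5) → unitInterval) (o a₁ a₂ a₃ b : Fin 5) (h01 : o ≠ a₁) (h02 : o ≠ a₂) (h03 : o ≠ a₃)
    (h04 : o ≠ b) (h12 : a₁ ≠ a₂) (h13 : a₁ ≠ a₃) (h14 : a₁ ≠ b) (h23 : a₂ ≠ a₃) (h24 : a₂ ≠ b) (h34 : a₃ ≠ b) :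
    0 ≤ cval w (t3Terms ((o, a₁, a₂, a₃, b) : Tup 5)) := by
  obtain ⟨σ, hσ⟩ := cover_distinct _ (mem_distinctTuples h01 h02 h03 h04 h12 h13 h14 h23 h24 h34)
  rw [← hσ]
  exact t3Holds_forall_relabel σ t3Holds_t₀ w

/-- `T2_Q` unfolded: with `μ = prodBernoulli w`, `Q = (openConn a₁ a₂)ᶜ`, `DQ = (openConn a₃ a₁)ᶜ ∩ (openConn a₃ a₂)ᶜ ∩ Q`,
the `cval` of `t2Terms` is the signed sum of the four triple products displayed in the module docstring. [this work] -/
theorem t2Q_five_explicit (w : Sym2 (Fin 5) → unitInterval) (o a₁ a₂ a₃ b : Fin 5) (h01 : o ≠ a₁) (h02 : o ≠ a₂)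
    (h03 : o ≠ a₃) (h04 : o ≠ b) (h12 : a₁ ≠ a₂) (h13 : a₁ ≠ a₃) (h14 : a₁ ≠ b) (h23 : a₂ ≠ a₃) (h24 : a₂ ≠ b) (h34 : a₃ ≠ b) :
    (prodBernoulli w).real ((openConn a₃ a₁)ᶜ ∩ (openConn a₃ a₂)ᶜ ∩ (openConn a₁ a₂)ᶜ : Set (BondConfig (Fin 5))) *
        (prodBernoulli w).real ((openConn b a₂ ∩ (openConn a₁ a₂)ᶜ : Set (BondConfig (Fin 5)))) *
        (prodBernoulli w).real ((openConn o a₂ ∩ (openConn a₁ a₂)ᶜ : Set (BondConfig (Fin 5)))) +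
      (prodBernoulli w).real ((openConn a₃ a₁)ᶜ ∩ (openConn a₃ a₂)ᶜ ∩ (openConn a₁ a₂)ᶜ ∩ openConn o a₃ : Set (BondConfig (Fin 5))) *
        (prodBernoulli w).real ((openConn a₁ a₂)ᶜ : Set (BondConfig (Fin 5))) *
        (prodBernoulli w).real ((openConn b a₂ ∩ openConn a₃ a₂ ∩ (openConn a₁ a₂)ᶜ : Set (BondConfig (Fin 5)))) ≤
    (prodBernoulli w).real ((openConn a₃ a₁)ᶜ ∩ (openConn a₃ a₂)ᶜ ∩ (openConn a₁ a₂)ᶜ : Set (BondConfig (Fin 5))) *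
        (prodBernoulli w).real ((openConn a₁ a₂)ᶜ : Set (BondConfig (Fin 5))) *
        (prodBernoulli w).real ((openConn b a₂ ∩ openConn o a₂ ∩ (openConn a₁ a₂)ᶜ : Set (BondConfig (Fin 5)))) +
      (prodBernoulli w).real ((openConn a₃ a₁)ᶜ ∩ (openConn a₃ a₂)ᶜ ∩ (openConn a₁ a₂)ᶜ ∩ openConn o a₃ : Set (BondConfig (Fin 5))) *
        (prodBernoulli w).real ((openConn b a₂ ∩ (openConn a₁ a₂)ᶜ : Set (BondConfig (Fin 5)))) *
        (prodBernoulli w).real ((openConn a₃ a₂ ∩ (openConn a₁ a₂)ᶜ : Set (BondConfig (Fin 5)))) := by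
  have h := t2Q_five w o a₁ a₂ a₃ b h01 h02 h03 h04 h12 h13 h14 h23 h24 h34
  unfold cval t2Terms pr at h
  have e1 : connEvent (pDQ ((o, a₁, a₂, a₃, b) : Tup 5)) =
      ((openConn a₃ a₁)ᶜ ∩ (openConn a₃ a₂)ᶜ ∩ (openConn a₁ a₂)ᶜ : Set (BondConfig (Fin 5))) := by
    ext ω; simp [connEvent, pDQ]
  have e2 : connEvent (pQ ((o, a₁, a₂, a₃, b) : Tup 5)) = ((openConn a₁ a₂)ᶜ : Set (BondConfig (Fin 5))) := by
    ext ω; simp [connEvent, pQ]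
  have e3 : connEvent (pDOQ ((o, a₁, a₂, a₃, b) : Tup 5)) =
      ((openConn a₃ a₁)ᶜ ∩ (openConn a₃ a₂)ᶜ ∩ (openConn a₁ a₂)ᶜ ∩ openConn o a₃ : Set (BondConfig (Fin 5))) := by
    ext ω; simp [connEvent, pDOQ, pDQ]
  have e4 : ∀ x y : Fin 5, connEvent (pIn2 ((o, a₁, a₂, a₃, b) : Tup 5) x y) =
      (openConn x a₂ ∩ openConn y a₂ ∩ (openConn a₁ a₂)ᶜ : Set (BondConfig (Fin 5))) := by
    intro x y; ext ω; simp [connEvent, pIn2, pQ]; tauto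
  have e5 : ∀ x : Fin 5, connEvent (pIn ((o, a₁, a₂, a₃, b) : Tup 5) x) =
      (openConn x a₂ ∩ (openConn a₁ a₂)ᶜ : Set (BondConfig (Fin 5))) := by
    intro x; ext ω; simp [connEvent, pIn, pQ]
  simp only [List.map_cons, List.map_nil, List.sum_cons, List.sum_nil, e1, e2, e3, e4, e5] at h
  push_cast at h
  linarith

end Summit.CriticalPhenomena.PercolationContinuityZ3.Theorems.CovPiComb
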